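/-
Copyright: pub-rosobs cell (Resolution Observatory), carver gen 42.  Companion file; statements OURS, in
the cell's polynomial weighted-centre model `W(f)`.  Instrument — NOT a resolution theorem.
-/
import Literature.AlgebraicGeometry.Resolution.WeightedCentreHandlePowMax
import HarnessLib

/-!
# Two handles: `max W(X_a^m X_b + X_c^n X_d) = (m+1, m+1, n+1, n+1)` (`1 ≤ m ≤ n`), every characteristic

[cite: AbramovichTemkinWlodarczyk2024, Thm. 5.3.1 (2)–(3) (p. 1578) (`inv = max (b₁,…,b_k)` over admissible
centres), Lemma 5.2.6 (p. 1576), §5.1 (p. 1575)] [cite: CossartJannsenSaito2020, Def. 1.26 / Lemma 1.27 (`τ`),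
Def. 8.2 (p. 118), Def. 8.13 (pp. 120–121), Def. 8.15, Thm. 8.16 (p. 121), Thm. 8.22 (a) (p. 124) (`δ`, solvable
vertices, `δ`-preparedness)].

The `{handle, handle}` block pair of the census's pure-power / handle family law (engine 1, FE33 C136 (d):
`max W(Σ X_i^{e_i} + Σ X_{b_j}^{m_j} X_{c_j}) = sort (CL_p(e) ∪ {m_j + 1, m_j + 1})`), in the polynomial model,
EVERY field `k`, any number of spectator variables: for pairwise distinct `a, b, c, d` and `1 ≤ m`, `1 ≤ n`,

  `max W(X_a^m X_b + X_c^n X_d) = (min + 1, min + 1, max + 1, max + 1)`, `min = min (m, n)`, `max = max (m, n)`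

(`isMaxInv_twoHandles_law`, `isMaxInv_X_pow_mul_X_add_X_pow_mul_X`; in the family's own language
`isMaxInv_pureHandle_pair`: `max W(pureHandle [] [(a,m,b),(c,n,d)]) = familyExps [] [(a,m,b),(c,n,d)]`), e.g.
`xy + zw ↦ (2,2,2,2)`, `xy + z²w ↦ (2,2,3,3)`, `x²y + z³w ↦ (3,3,4,4)`.  No characteristic hypothesis: the law's
cleaning `CL_p` does not act on handles.  With `WeightedCentrePowPairMax` (`{pure, pure}`) and
`WeightedCentreHandlePowMax` (`{pure, handle}`), every TWO-BLOCK case of C136 (d) is now a theorem of the model.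

Proof (`m < n`; `m = n` is the homogeneous case `τ = 4`, `isMaxInv_replicate_of_mem`; `m > n` by symmetry).  The
initial form is the lower handle `X_a^m X_b` (order `m + 1`, `τ = 2`, `hironakaTau_X_pow_mul_X`).  With the block
`S = {a, b}` of `y`-variables, Hironaka's polyhedron `Δ(f; u; y)` is the orthant at the single point
`(n ε_c + ε_d)/(m+1)` (`hironakaDelta_twoHandles`: `δ = (n+1)/(m+1)`), whose `d`-coordinate `1/(m+1)` is never an
integer: the polynomial model has NO vertex (`not_isVertex_twoHandles`), so `f` is `δ`-prepared for free in every
characteristic (`isDeltaPrepared_twoHandles`) and the `δ`-initial form is `f` itself (`deltaInitial_twoHandles`).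
`τ(f) = 4` (`hironakaTau_twoHandles`: an invariant translation `(Y_a+αT)^m (Y_b+βT) + (Y_c+γT)^n (Y_d+δT) =
Y_a^m Y_b + Y_c^n Y_d` has `α = β = γ = δ = 0` — kill `Y_a, Y_c`, then `Y_b` resp. `Y_d` and subtract).  The
`δ`-face count is obtained by EXHAUSTION OF TWISTS (`WeightedCentreTwistExhaustion.hironakaTau_deltaInitial_le_of_
forall_twist`), whose hypothesis `eq_zero_of_mem_invarianceSpace_twist_twoHandles` holds in every characteristic
WITHOUT a case split: after the shift `Y_a ↦ Y_a − Ξ_a`, `Y_b ↦ Y_b − Ξ_b` the invariance of the twisted polynomial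
under a direction `w` with `w_a = w_b = 0` reads `(Y_a + D_a)^m (Y_b + D_b) + (Y_c + w_cT)^n (Y_d + w_dT) =
Y_a^m Y_b + Y_c^n Y_d` (`D ∈ k[U, T]`); killing `Y_a`, then also `Y_b`, and subtracting gives `D_a^m Y_b = 0`, so
`D_a = 0`, and then the far handle is invariant: `w_c = w_d = 0` (`τ(Y_c^n Y_d) = 2`).  Hence every admissible
invariant with all weights `≤ 1/(m+1)` is `(m+1, m+1, e₃, …)` with `e₃ ≤ (m+1)δ = n+1`
(`succ_card_le_countP_exps_of_isDeltaPrepared`), and if `e₃ = n+1` the exhaustion count gives a FOURTH entry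
`≤ n+1` (this is where `τ(f) = 4` enters: `(m+1, m+1, n+1)` alone would beat `(m+1, m+1, n+1, n+1)` in the
truncated order); a weight `> 1/(m+1)` gives a head `< m+1`.  The coordinate centre `(X_a, X_b, X_c, X_d)` with
weights `(1/(m+1), 1/(m+1), 1/(n+1), 1/(n+1))` attains the value (`WeightedCentrePureHandleFamily.familyExps_mem`).
-/

noncomputable section

open MvPolynomial

namespace Literature.AlgebraicGeometry.Resolution.WeightedBlowup

variable {k : Type*} [Field k] {N : ℕ}

/-! ## §1 The polynomial and its Newton data -/

section Defs

variable (k) in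
/-- `twoHandles k a b c d m n = X_a^m X_b + X_c^n X_d`: two handles on disjoint variables.
[cite: AbramovichTemkinWlodarczyk2024, §5.1 (p. 1575)] -/
def twoHandles (a b c d : Fin N) (m n : ℕ) : MvPolynomial (Fin N) k := X a ^ m * X b + X c ^ n * X d

end Defs

variable {a b c d : Fin N} {m n : ℕ}

/-- Unfolding (plumbing). [cite: AbramovichTemkinWlodarczyk2024, §5.1 (p. 1575)] -/
theorem twoHandles_eq : twoHandles k a b c d m n = X a ^ m * X b + X c ^ n * X d := rfl

/-- Swapping the two handles (plumbing). [cite: AbramovichTemkinWlodarczyk2024, §5.1 (p. 1575)] -/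
theorem twoHandles_swap : twoHandles k a b c d m n = twoHandles k c d a b n m := add_comm _ _

/-- A handle is a monomial (plumbing). [folklore] -/
private theorem X_pow_mul_X_eq₁₂ (a b : Fin N) (m : ℕ) :
    (X a ^ m * X b : MvPolynomial (Fin N) k) = monomial (Finsupp.single a m + Finsupp.single b 1) 1 := by
  rw [show (X b : MvPolynomial (Fin N) k) = X b ^ 1 from (pow_one _).symm, X_pow_eq_monomial,
    X_pow_eq_monomial, monomial_mul, mul_one]

/-- The two exponents are distinct (they differ at `d`) (plumbing). [folklore] -/
private theorem hExp_ne₁₂ (had : a ≠ d) (hbd : b ≠ d) (hcd : c ≠ d) :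
    (Finsupp.single a m + Finsupp.single b 1 : Fin N →₀ ℕ) ≠ Finsupp.single c n + Finsupp.single d 1 := by
  intro h
  simpa [Finsupp.single_apply, had, hbd, hcd] using congrArg (fun D => D d) h

/-- Coefficients of `X_a^m X_b + X_c^n X_d` (plumbing). [folklore] -/
private theorem coeff_twoHandles (D : Fin N →₀ ℕ) :
    coeff D (twoHandles k a b c d m n) =
      (if Finsupp.single a m + Finsupp.single b 1 = D then 1 else 0) +
        (if Finsupp.single c n + Finsupp.single d 1 = D then 1 else 0) := by
  rw [twoHandles, coeff_add, X_pow_mul_X_eq₁₂, X_pow_mul_X_eq₁₂, coeff_monomial, coeff_monomial]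

/-- The support of `X_a^m X_b + X_c^n X_d`. (derived here) [cite: CossartJannsenSaito2020, Def. 8.2 (p. 118)] -/
theorem support_twoHandles (had : a ≠ d) (hbd : b ≠ d) (hcd : c ≠ d) :
    (twoHandles k a b c d m n).support =
      {Finsupp.single a m + Finsupp.single b 1, Finsupp.single c n + Finsupp.single d 1} := by
  classical
  have hne := hExp_ne₁₂ (m := m) (n := n) had hbd hcd
  ext D
  rw [mem_support_iff, coeff_twoHandles, Finset.mem_insert, Finset.mem_singleton]
  constructor
  · intro h
    by_contra hD
    push Not at hD
    rw [if_neg (Ne.symm hD.1), if_neg (Ne.symm hD.2), add_zero] at h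
    exact h rfl
  · rintro (rfl | rfl)
    · rw [if_pos rfl, if_neg (Ne.symm hne)]; norm_num
    · rw [if_pos rfl, if_neg hne]; norm_num

/-- The degree of a handle exponent (plumbing). [folklore] -/
private theorem degree_hExp₁₂ (a b : Fin N) (m : ℕ) :
    (Finsupp.single a m + Finsupp.single b 1 : Fin N →₀ ℕ).degree = m + 1 := by
  rw [map_add, Finsupp.degree_single, Finsupp.degree_single]

/-- `ord (X_a^m X_b + X_c^n X_d) = m + 1` for `m ≤ n`. (derived here) [cite: CossartJannsenSaito2020, Def. 8.2 (p. 118)] -/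
theorem monomialOrd_twoHandles (had : a ≠ d) (hbd : b ≠ d) (hcd : c ≠ d) (hmn : m ≤ n) :
    monomialOrd (fun _ => 1) (twoHandles k a b c d m n) = ((m + 1 : ℕ) : ℕ∞) := by
  classical
  have hmem : Finsupp.single a m + Finsupp.single b 1 ∈ (twoHandles k a b c d m n).support := by
    rw [support_twoHandles had hbd hcd]; exact Finset.mem_insert_self _ _
  apply le_antisymm
  · refine (monomialOrd_le_weight (fun _ => 1) hmem).trans ?_
    rw [← Finsupp.degree_eq_weight_one, degree_hExp₁₂]
  · rw [le_monomialOrd_one_iff]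
    intro D hD
    rw [support_twoHandles had hbd hcd, Finset.mem_insert, Finset.mem_singleton] at hD
    rcases hD with rfl | rfl
    · rw [degree_hExp₁₂]
    · rw [degree_hExp₁₂]; exact Nat.succ_le_succ hmn

/-- A handle is homogeneous of degree `m + 1` (plumbing). [folklore] -/
private theorem isHomogeneous_X_pow_mul_X₁₂ (a b : Fin N) (m : ℕ) :
    (X a ^ m * X b : MvPolynomial (Fin N) k).IsHomogeneous (m + 1) :=
  (isHomogeneous_X_pow a m).mul (isHomogeneous_X k b)

/-- The initial form of `X_a^m X_b + X_c^n X_d` is the lower handle `X_a^m X_b` for `m < n`. (derived here)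
[cite: CossartJannsenSaito2020, Def. 8.2 (p. 118)] -/
theorem homogeneousComponent_twoHandles (hmn : m < n) :
    homogeneousComponent (m + 1) (twoHandles k a b c d m n) = X a ^ m * X b := by
  rw [twoHandles, map_add, homogeneousComponent_of_mem (isHomogeneous_X_pow_mul_X₁₂ a b m),
    homogeneousComponent_of_mem (isHomogeneous_X_pow_mul_X₁₂ c d n), if_pos rfl,
    if_neg (by omega : m + 1 ≠ n + 1), add_zero]

/-- The initial form lives on the block `{a, b}` (plumbing). [folklore] -/
private theorem hFS_twoHandles (hmn : m < n) :
    ∀ D ∈ (homogeneousComponent (m + 1) (twoHandles k a b c d m n)).support,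
      ∀ x ∉ ({a, b} : Finset (Fin N)), D x = 0 := by
  classical
  intro D hD x hx
  rw [homogeneousComponent_twoHandles hmn, X_pow_mul_X_eq₁₂] at hD
  have hD' := Finset.mem_singleton.1 (support_monomial_subset hD)
  simp only [Finset.mem_insert, Finset.mem_singleton, not_or] at hx
  rw [hD', Finsupp.add_apply, Finsupp.single_apply, Finsupp.single_apply, if_neg (Ne.symm hx.1),
    if_neg (Ne.symm hx.2), add_zero]

/-- `|B| = 0` forces the exponent to vanish on the block (plumbing). [folklore] -/
private theorem apply_eq_zero_of_blockDeg_eq_zero₁₂ {S : Finset (Fin N)} {D : Fin N →₀ ℕ}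
    (h : blockDeg S D = 0) : ∀ x ∈ S, D x = 0 := by
  classical
  intro x hx
  by_contra hne
  unfold blockDeg at h
  exact hne (Finset.sum_eq_zero_iff.1 h x (Finset.mem_filter.2 ⟨Finsupp.mem_support_iff.2 hne, hx⟩))

/-- Block data of the near handle `X_a^m X_b` with respect to `S = {a, b}` (plumbing). [folklore] -/
private theorem coDeg_near₁₂ :
    coDeg ({a, b} : Finset (Fin N)) (Finsupp.single a m + Finsupp.single b 1) = 0 := by
  classical
  unfold coDeg
  refine Finset.sum_eq_zero fun x hx => ?_
  rw [Finset.mem_filter] at hx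
  exfalso
  apply hx.2
  rcases Finset.mem_union.1 (Finsupp.support_add hx.1) with h | h
  · rw [Finset.mem_singleton.1 (Finsupp.support_single_subset h)]
    exact Finset.mem_insert_self _ _
  · rw [Finset.mem_singleton.1 (Finsupp.support_single_subset h)]
    exact Finset.mem_insert_of_mem (Finset.mem_singleton_self _)

/-- Block data of the near handle (plumbing). [folklore] -/
private theorem blockDeg_near₁₂ :
    blockDeg ({a, b} : Finset (Fin N)) (Finsupp.single a m + Finsupp.single b 1) = m + 1 := by
  have h := blockDeg_add_coDeg ({a, b} : Finset (Fin N)) (Finsupp.single a m + Finsupp.single b 1)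
  rw [coDeg_near₁₂, add_zero, degree_hExp₁₂] at h
  exact h

/-- Block data of the far handle `X_c^n X_d` with respect to `S = {a, b}` (plumbing). [folklore] -/
private theorem far_apply_eq_zero₁₂ (hac : a ≠ c) (had : a ≠ d) (hbc : b ≠ c) (hbd : b ≠ d) :
    ∀ x ∈ ({a, b} : Finset (Fin N)), (Finsupp.single c n + Finsupp.single d 1 : Fin N →₀ ℕ) x = 0 := by
  intro x hx
  rcases Finset.mem_insert.1 hx with rfl | hx
  · rw [Finsupp.add_apply, Finsupp.single_apply, Finsupp.single_apply, if_neg (Ne.symm hac),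
      if_neg (Ne.symm had), add_zero]
  · rw [Finset.mem_singleton.1 hx, Finsupp.add_apply, Finsupp.single_apply, Finsupp.single_apply,
      if_neg (Ne.symm hbc), if_neg (Ne.symm hbd), add_zero]

/-- Block data of the far handle (plumbing). [folklore] -/
private theorem blockDeg_far₁₂ (hac : a ≠ c) (had : a ≠ d) (hbc : b ≠ c) (hbd : b ≠ d) :
    blockDeg ({a, b} : Finset (Fin N)) (Finsupp.single c n + Finsupp.single d 1) = 0 := by
  classical
  unfold blockDeg
  exact Finset.sum_eq_zero fun x hx => far_apply_eq_zero₁₂ hac had hbc hbd x (Finset.mem_filter.1 hx).2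

/-- Block data of the far handle (plumbing). [folklore] -/
private theorem coDeg_far₁₂ (hac : a ≠ c) (had : a ≠ d) (hbc : b ≠ c) (hbd : b ≠ d) :
    coDeg ({a, b} : Finset (Fin N)) (Finsupp.single c n + Finsupp.single d 1) = n + 1 := by
  have h := blockDeg_add_coDeg ({a, b} : Finset (Fin N)) (Finsupp.single c n + Finsupp.single d 1)
  rw [blockDeg_far₁₂ hac had hbc hbd, zero_add, degree_hExp₁₂] at h
  exact h

/-- Block data of the far handle (plumbing). [folklore] -/
private theorem coPart_far₁₂ (hac : a ≠ c) (had : a ≠ d) (hbc : b ≠ c) (hbd : b ≠ d) :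
    coPart ({a, b} : Finset (Fin N)) (Finsupp.single c n + Finsupp.single d 1) =
      Finsupp.single c n + Finsupp.single d 1 := by
  classical
  rw [coPart, Finsupp.filter_eq_self_iff]
  intro x hx hxS
  exact hx (far_apply_eq_zero₁₂ hac had hbc hbd x hxS)

/-- **Hironaka's `δ(X_a^m X_b + X_c^n X_d; u; (X_a, X_b)) = (n+1)/(m+1)`**: the polyhedron `Δ(f; u; y)` is the
orthant at the point `(n ε_c + ε_d)/(m+1)`. (derived here) [cite: CossartJannsenSaito2020, Def. 8.2 (p. 118) (δ(f; u; y))] -/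
theorem hironakaDelta_twoHandles (hac : a ≠ c) (had : a ≠ d) (hbc : b ≠ c) (hbd : b ≠ d) (hcd : c ≠ d) :
    hironakaDelta {a, b} (m + 1) (twoHandles k a b c d m n) =
      (((((n + 1 : ℕ) : ℚ) / ((m + 1 : ℕ) : ℚ)) : ℚ) : WithTop ℚ) := by
  classical
  have hmem : Finsupp.single c n + Finsupp.single d 1 ∈ (twoHandles k a b c d m n).support := by
    rw [support_twoHandles had hbd hcd, Finset.mem_insert, Finset.mem_singleton]; exact Or.inr rfl
  apply le_antisymm
  · unfold hironakaDelta
    refine (Finset.inf_le (Finset.mem_filter.2 ⟨hmem, ?_⟩)).trans ?_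
    · rw [blockDeg_far₁₂ hac had hbc hbd]; exact Nat.succ_pos m
    · rw [blockDeg_far₁₂ hac had hbc hbd, coDeg_far₁₂ hac had hbc hbd, Nat.sub_zero]
  · rw [le_hironakaDelta_iff]
    intro D hD hb
    rw [support_twoHandles had hbd hcd, Finset.mem_insert, Finset.mem_singleton] at hD
    rcases hD with rfl | rfl
    · rw [blockDeg_near₁₂] at hb; exact (lt_irrefl _ hb).elim
    · rw [blockDeg_far₁₂ hac had hbc hbd, coDeg_far₁₂ hac had hbc hbd, Nat.sub_zero]

/-! ## §2 `δ`-preparedness: the polynomial model has no vertex at all -/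

/-- **No vertex**: the only candidate vertex `(n ε_c + ε_d)/(m+1)` of `Δ(X_a^m X_b + X_c^n X_d; u; (X_a, X_b))`
has `d`-coordinate `1/(m+1)`, so for `m ≥ 1` it is never a lattice point and the polynomial model has no vertex
(every characteristic). (derived here)
[cite: CossartJannsenSaito2020, Def. 8.1 (2), Def. 8.2 (1) (pp. 117–118), Thm. 8.22 (a) (p. 124) (solvable vertices are lattice points)] -/
theorem not_isVertex_twoHandles (hac : a ≠ c) (had : a ≠ d) (hbc : b ≠ c) (hbd : b ≠ d) (hcd : c ≠ d)
    (hm : 1 ≤ m) (v : Fin N →₀ ℕ) : ¬ IsVertex {a, b} (m + 1) (twoHandles k a b c d m n) v := by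
  classical
  rintro ⟨⟨D, hD, hlt, hco⟩, -⟩
  rw [support_twoHandles had hbd hcd, Finset.mem_insert, Finset.mem_singleton] at hD
  rcases hD with rfl | rfl
  · rw [blockDeg_near₁₂] at hlt
    exact lt_irrefl _ hlt
  · rw [blockDeg_far₁₂ hac had hbc hbd, Nat.sub_zero, coPart_far₁₂ hac had hbc hbd] at hco
    have h1 : (Finsupp.single c n + Finsupp.single d 1 : Fin N →₀ ℕ) d = ((m + 1) • v) d := by rw [hco]
    rw [Finsupp.add_apply, Finsupp.single_apply, if_neg hcd, Finsupp.single_eq_same, Finsupp.smul_apply,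
      smul_eq_mul, zero_add] at h1
    have h2 : m + 1 = 1 := Nat.eq_one_of_mul_eq_one_right h1.symm
    omega

/-- **`X_a^m X_b + X_c^n X_d` is `δ`-prepared with respect to `(y; u) = ((X_a, X_b); rest)`** in EVERY
characteristic (`m ≥ 1`): there is no vertex to solve. (derived here)
[cite: CossartJannsenSaito2020, Def. 8.13 (pp. 120–121), Def. 8.15 (p. 121), Thm. 8.22 (a) (p. 124)] -/
theorem isDeltaPrepared_twoHandles (hac : a ≠ c) (had : a ≠ d) (hbc : b ≠ c) (hbd : b ≠ d) (hcd : c ≠ d)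
    (hm : 1 ≤ m) : IsDeltaPrepared {a, b} (m + 1) (twoHandles k a b c d m n) :=
  fun v hv _ _ => not_isVertex_twoHandles hac had hbc hbd hcd hm v hv

/-- **The `δ`-initial form is the whole polynomial**: both monomials of `X_a^m X_b + X_c^n X_d` lie on the
`δ`-face `|A| = δ (ν − |B|)`, `δ = (n+1)/(m+1)`, `ν = m + 1`. (derived here)
[cite: CossartJannsenSaito2020, Def. 8.2 (4) (p. 118) (in_δ(f))] -/
theorem deltaInitial_twoHandles (hac : a ≠ c) (had : a ≠ d) (hbc : b ≠ c) (hbd : b ≠ d) (hcd : c ≠ d) :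
    deltaInitial {a, b} (m + 1) (((n + 1 : ℕ) : ℚ) / ((m + 1 : ℕ) : ℚ)) (twoHandles k a b c d m n) =
      twoHandles k a b c d m n := by
  classical
  have hM0 : (((m + 1 : ℕ) : ℚ)) ≠ 0 := by positivity
  refine deltaInitial_eq_self fun D hD => ?_
  rw [support_twoHandles had hbd hcd, Finset.mem_insert, Finset.mem_singleton] at hD
  rcases hD with rfl | rfl
  · refine ⟨blockDeg_near₁₂.le, ?_⟩
    rw [coDeg_near₁₂, blockDeg_near₁₂, Nat.sub_self, Nat.cast_zero, mul_zero]
  · refine ⟨by rw [blockDeg_far₁₂ hac had hbc hbd]; exact Nat.zero_le _, ?_⟩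
    rw [coDeg_far₁₂ hac had hbc hbd, blockDeg_far₁₂ hac had hbc hbd, Nat.sub_zero, div_mul_cancel₀ _ hM0]

/-! ## §3 `τ = 4`: no translation leaves `X_a^m X_b + X_c^n X_d` invariant -/

/-- `killVar` fixes constants (plumbing). [folklore] -/
private theorem killVar_C₁₂ {σ : Type*} [DecidableEq σ] (x : σ) (r : k) :
    killVar x (C r : MvPolynomial σ k) = C r := by
  simp [killVar]

/-- `(αT)^m Y = 0` forces `α = 0` (plumbing). [folklore] -/
private theorem eq_zero_of_C_mul_X_pow_mul_X₁₂ {σ : Type*} {α : k} {t y : σ} {m : ℕ}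
    (h : ((C α * X t) ^ m * X y : MvPolynomial σ k) = 0) : α = 0 := by
  rcases mul_eq_zero.1 h with h | h
  · by_contra hα
    exact pow_ne_zero m (mul_ne_zero (fun h' => hα (C_eq_zero.1 h')) (X_ne_zero t)) h
  · exact absurd h (X_ne_zero y)

/-- `Y^m (βT) = 0` forces `β = 0` (plumbing). [folklore] -/
private theorem eq_zero_of_X_pow_mul_C_mul_X₁₂ {σ : Type*} {β : k} {t y : σ} {m : ℕ}
    (h : (X y ^ m * (C β * X t) : MvPolynomial σ k) = 0) : β = 0 := by
  rcases mul_eq_zero.1 h with h | h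
  · exact absurd h (pow_ne_zero m (X_ne_zero y))
  · by_contra hβ
    exact mul_ne_zero (fun h' => hβ (C_eq_zero.1 h')) (X_ne_zero t) h

/-- An invariant translation of one handle `Y_c^n Y_d` is trivial (plumbing; the computation behind
`hironakaTau_X_pow_mul_X`). [cite: CossartJannsenSaito2020, Def. 1.26 / Lemma 1.27 (τ = codimension of the directrix)] -/
private theorem eq_zero_of_translate_handle₁₂ (hcd : c ≠ d) (hn : 1 ≤ n) {γ δ : k}
    (h : ((X (some c) + C γ * X none) ^ n * (X (some d) + C δ * X none) : MvPolynomial (Option (Fin N)) k) =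
      X (some c) ^ n * X (some d)) : γ = 0 ∧ δ = 0 := by
  classical
  have hn0 : n ≠ 0 := by omega
  have hsdc : (some d : Option (Fin N)) ≠ some c := fun h' => hcd (Option.some_injective _ h').symm
  have hnc : (none : Option (Fin N)) ≠ some c := (Option.some_ne_none c).symm
  have hdn : (some d : Option (Fin N)) ≠ none := Option.some_ne_none d
  -- kill `Y_c`
  have h1 := congrArg (killVar (some c)) h
  simp only [map_mul, map_pow, map_add, killVar_X, killVar_C₁₂, if_true, hsdc, hnc, if_false, zero_add,
    zero_pow hn0, zero_mul] at h1
  -- h1 : (C γ * X none) ^ n * (X (some d) + C δ * X none) = 0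
  have hγ : γ = 0 := by
    rcases mul_eq_zero.1 h1 with h1 | h1
    · by_contra hγ
      exact pow_ne_zero n (mul_ne_zero (fun h' => hγ (C_eq_zero.1 h')) (X_ne_zero none)) h1
    · exfalso
      have h1' := congrArg (killVar none) h1
      simp only [map_add, map_mul, map_zero, killVar_X, killVar_C₁₂, hdn, if_false, if_true, mul_zero,
        add_zero] at h1'
      exact X_ne_zero (some d) h1'
  refine ⟨hγ, ?_⟩
  subst hγ
  rw [C_0, zero_mul, add_zero, mul_add] at h
  -- h : Y_c^n Y_d + Y_c^n (δ T) = Y_c^n Y_d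
  have h2 : (X (some c) : MvPolynomial (Option (Fin N)) k) ^ n * (C δ * X none) = 0 :=
    add_left_cancel (h.trans (add_zero _).symm)
  exact eq_zero_of_X_pow_mul_C_mul_X₁₂ h2

/-- An invariant translation of `Y_a^m Y_b + Y_c^n Y_d` is trivial (plumbing): from
`(Y_a+αT)^m (Y_b+βT) + (Y_c+γT)^n (Y_d+δT) = Y_a^m Y_b + Y_c^n Y_d` kill `Y_a` and `Y_c`
(`(αT)^m (Y_b+βT) + (γT)^n (Y_d+δT) = 0`), then also `Y_b` resp. `Y_d` and subtract: `(αT)^m Y_b = 0`,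
`(γT)^n Y_d = 0`, so `α = γ = 0`; then `Y_a^m βT + Y_c^n δT = 0` and killing `Y_c` resp. `Y_a` gives `β = δ = 0`.
[cite: CossartJannsenSaito2020, Def. 1.26 / Lemma 1.27 (τ = codimension of the directrix)] -/
private theorem eq_zero_of_translate_twoHandles (hab : a ≠ b) (hac : a ≠ c) (had : a ≠ d) (hbc : b ≠ c)
    (hbd : b ≠ d) (hcd : c ≠ d) (hm : 1 ≤ m) (hn : 1 ≤ n) {α β γ δ : k}
    (h : ((X (some a) + C α * X none) ^ m * (X (some b) + C β * X none) +
          (X (some c) + C γ * X none) ^ n * (X (some d) + C δ * X none) : MvPolynomial (Option (Fin N)) k) =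
        X (some a) ^ m * X (some b) + X (some c) ^ n * X (some d)) :
    α = 0 ∧ β = 0 ∧ γ = 0 ∧ δ = 0 := by
  classical
  have hm0 : m ≠ 0 := by omega
  have hn0 : n ≠ 0 := by omega
  have hne : ∀ {x y : Fin N}, x ≠ y → (some x : Option (Fin N)) ≠ some y := fun hxy h' =>
    hxy (Option.some_injective _ h')
  have hns : ∀ x : Fin N, (none : Option (Fin N)) ≠ some x := fun x => (Option.some_ne_none x).symm
  -- kill `Y_a`, then `Y_c`
  have h1 := congrArg (killVar (some a)) h
  simp only [map_add, map_mul, map_pow, killVar_X, killVar_C₁₂, if_true, hne hab.symm, hne hac.symm,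
    hne had.symm, hns, if_false, zero_add, zero_pow hm0, zero_mul] at h1
  -- h1 : (αT)^m (Y_b + βT) + (Y_c + γT)^n (Y_d + δT) = Y_c^n Y_d
  have h2 := congrArg (killVar (some c)) h1
  simp only [map_add, map_mul, map_pow, killVar_X, killVar_C₁₂, if_true, hne hbc, hne hcd.symm, hns,
    if_false, zero_add, zero_pow hn0, zero_mul] at h2
  -- h2 : (αT)^m (Y_b + βT) + (γT)^n (Y_d + δT) = 0
  -- kill `Y_b` resp. `Y_d` as well and subtract
  have h3 := congrArg (killVar (some b)) h2
  simp only [map_add, map_mul, map_pow, map_zero, killVar_X, killVar_C₁₂, if_true, hne hbd.symm, hns,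
    if_false, zero_add] at h3
  -- h3 : (αT)^m (βT) + (γT)^n (Y_d + δT) = 0
  have h4 := congrArg (killVar (some d)) h2
  simp only [map_add, map_mul, map_pow, map_zero, killVar_X, killVar_C₁₂, if_true, hne hbd, hns, if_false,
    zero_add] at h4
  -- h4 : (αT)^m (Y_b + βT) + (γT)^n (δT) = 0
  have h5 : (C α * X none) ^ m * X (some b) = (0 : MvPolynomial (Option (Fin N)) k) := by
    linear_combination h2 - h3
  have h6 : (C γ * X none) ^ n * X (some d) = (0 : MvPolynomial (Option (Fin N)) k) := by
    linear_combination h2 - h4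
  have hα : α = 0 := eq_zero_of_C_mul_X_pow_mul_X₁₂ h5
  have hγ : γ = 0 := eq_zero_of_C_mul_X_pow_mul_X₁₂ h6
  subst hα hγ
  simp only [C_0, zero_mul, add_zero] at h
  -- h : Y_a^m (Y_b + βT) + Y_c^n (Y_d + δT) = Y_a^m Y_b + Y_c^n Y_d
  have h7 : X (some a) ^ m * (C β * X none) + X (some c) ^ n * (C δ * X none) =
      (0 : MvPolynomial (Option (Fin N)) k) := by
    linear_combination h
  -- kill `Y_c` resp. `Y_a`
  have h8 := congrArg (killVar (some c)) h7
  simp only [map_add, map_mul, map_pow, map_zero, killVar_X, killVar_C₁₂, if_true, hne hac, hns, if_false,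
    zero_pow hn0, zero_mul, add_zero] at h8
  -- h8 : Y_a^m (βT) = 0
  have h9 := congrArg (killVar (some a)) h7
  simp only [map_add, map_mul, map_pow, map_zero, killVar_X, killVar_C₁₂, if_true, hne hac.symm, hns,
    if_false, zero_pow hm0, zero_mul, zero_add] at h9
  -- h9 : Y_c^n (δT) = 0
  exact ⟨rfl, eq_zero_of_X_pow_mul_C_mul_X₁₂ h8, rfl, eq_zero_of_X_pow_mul_C_mul_X₁₂ h9⟩

/-- **`τ(X_a^m X_b + X_c^n X_d) = 4`** (`a, b, c, d` pairwise distinct, `m, n ≥ 1`; spectators allowed, every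
characteristic): no non-zero translation leaves the polynomial invariant. (derived here)
[cite: CossartJannsenSaito2020, Def. 1.26 / Lemma 1.27 (τ = codimension of the directrix)] -/
theorem hironakaTau_twoHandles (hab : a ≠ b) (hac : a ≠ c) (had : a ≠ d) (hbc : b ≠ c) (hbd : b ≠ d)
    (hcd : c ≠ d) (hm : 1 ≤ m) (hn : 1 ≤ n) : hironakaTau k {twoHandles k a b c d m n} = 4 := by
  classical
  have hcard : ({a, b, c, d} : Finset (Fin N)).card = 4 := by
    have h1 : a ∉ ({b, c, d} : Finset (Fin N)) := by simp [hab, hac, had]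
    have h2 : b ∉ ({c, d} : Finset (Fin N)) := by simp [hbc, hbd]
    rw [Finset.card_insert_of_notMem h1, Finset.card_insert_of_notMem h2, Finset.card_pair hcd]
  rw [← hcard]
  refine hironakaTau_singleton_eq_card ?_ ?_
  · intro x hx
    rw [twoHandles] at hx
    simp only [Finset.mem_insert, Finset.mem_singleton]
    rcases Finset.mem_union.1 (vars_add_subset _ _ hx) with h | h <;>
      rcases Finset.mem_union.1 (vars_mul _ _ h) with h | h
    · have h' := vars_pow _ _ h
      rw [vars_X, Finset.mem_singleton] at h'
      exact Or.inl h'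
    · rw [vars_X, Finset.mem_singleton] at h
      exact Or.inr (Or.inl h)
    · have h' := vars_pow _ _ h
      rw [vars_X, Finset.mem_singleton] at h'
      exact Or.inr (Or.inr (Or.inl h'))
    · rw [vars_X, Finset.mem_singleton] at h
      exact Or.inr (Or.inr (Or.inr h))
  · intro w hw x hx
    have h := (mem_invarianceSpace_iff k).1 hw _ (Set.mem_singleton _)
    simp only [twoHandles, map_add, map_mul, map_pow, rename_X, translate_X_some] at h
    obtain ⟨ha, hb, hc, hd⟩ := eq_zero_of_translate_twoHandles hab hac had hbc hbd hcd hm hn h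
    simp only [Finset.mem_insert, Finset.mem_singleton] at hx
    rcases hx with rfl | rfl | rfl | rfl
    · exact ha
    · exact hb
    · exact hc
    · exact hd

/-! ## §4 Exhaustion of twists for two handles (every characteristic, no case split) -/

/-- An `aeval` fixing the variables of `s` fixes `k[X_s]` (plumbing). [folklore] -/
private theorem aeval_eq_self_of_mem_supported₁₂ {σ' : Type*} {s : Set σ'} (g : σ' → MvPolynomial σ' k)
    (hg : ∀ v ∈ s, g v = X v) {P : MvPolynomial σ' k} (hP : P ∈ supported k s) : aeval g P = P := by
  have hle : supported k s ≤ AlgHom.equalizer (aeval g) (AlgHom.id k _) := by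
    rw [supported_eq_adjoin_X]
    refine Algebra.adjoin_le ?_
    rintro _ ⟨v, hv, rfl⟩
    rw [SetLike.mem_coe, AlgHom.mem_equalizer, AlgHom.id_apply, aeval_X]
    exact hg v hv
  exact (AlgHom.mem_equalizer _ _ _).mp (hle hP)

/-- An `aeval` maps `k[X_s]` into any subalgebra containing the images of `X_v`, `v ∈ s` (plumbing). [folklore] -/
private theorem aeval_mem_of_mem_supported₁₂ {σ' : Type*} {s : Set σ'} (g : σ' → MvPolynomial σ' k)
    {A : Subalgebra k (MvPolynomial σ' k)} (hg : ∀ v ∈ s, g v ∈ A) {P : MvPolynomial σ' k}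
    (hP : P ∈ supported k s) : aeval g P ∈ A := by
  have hle : supported k s ≤ A.comap (aeval g) := by
    rw [supported_eq_adjoin_X]
    refine Algebra.adjoin_le ?_
    rintro _ ⟨v, hv, rfl⟩
    rw [SetLike.mem_coe, Subalgebra.mem_comap, aeval_X]
    exact hg v hv
  exact hle hP

/-- **Exhaustion of twists for two handles (every characteristic).**  If a direction `w` with `w_a = w_b = 0`
leaves a twisted polynomial `(X_a + Ξ_a(U))^m (X_b + Ξ_b(U)) + X_c^n X_d` (`Ξ_a, Ξ_b ∈ k[U]`, `U = X_{≠ a, b}`)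
translation-invariant, then `w_c = w_d = 0`.  Proof: after the shift `Y_a ↦ Y_a − Ξ_a`, `Y_b ↦ Y_b − Ξ_b` the
invariance reads `(Y_a + D_a)^m (Y_b + D_b) + (Y_c + w_cT)^n (Y_d + w_dT) = Y_a^m Y_b + Y_c^n Y_d` with
`D_a = Ξ_a(U + wT) − Ξ_a(U)`, `D_b` likewise, both in `k[U, T]`; killing `Y_a` gives
`D_a^m (Y_b + D_b) + H_w = H_0` (`H_w`, `H_0` the two far handles), killing `Y_b` as well gives
`D_a^m D_b + H_w = H_0`, so `D_a^m Y_b = 0`, `D_a = 0`, and then `H_w = H_0`: the far handle is invariant, whence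
`w_c = w_d = 0` (`τ(Y_c^n Y_d) = 2`).  No derivative and no characteristic case split is needed. (derived here)
[cite: CossartJannsenSaito2020, Def. 8.13 (pp. 120–121), Thm. 8.22 (a) (p. 124); CossartPiltant2008, proof of Prop. 4.2] -/
theorem eq_zero_of_mem_invarianceSpace_twist_twoHandles (hab : a ≠ b) (hac : a ≠ c) (had : a ≠ d)
    (hbc : b ≠ c) (hbd : b ≠ d) (hcd : c ≠ d) (hm : 1 ≤ m) (hn : 1 ≤ n) {w : Fin N → k} (hwa : w a = 0)
    (hwb : w b = 0) {Ξ : Fin N → MvPolynomial (Fin N) k} (hΞa : ∀ D ∈ (Ξ a).support, D a = 0 ∧ D b = 0)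
    (hΞb : ∀ D ∈ (Ξ b).support, D a = 0 ∧ D b = 0)
    (hw : w ∈ invarianceSpace k {twist {a, b} Ξ (twoHandles k a b c d m n)}) : w c = 0 ∧ w d = 0 := by
  classical
  have hm0 : m ≠ 0 := by omega
  have hne : ∀ {x y : Fin N}, x ≠ y → (some x : Option (Fin N)) ≠ some y := fun hxy h' =>
    hxy (Option.some_injective _ h')
  have hns : ∀ x : Fin N, (none : Option (Fin N)) ≠ some x := fun x => (Option.some_ne_none x).symm
  -- the twisted polynomial and its translate
  have hF : twist {a, b} Ξ (twoHandles k a b c d m n) = (X a + Ξ a) ^ m * (X b + Ξ b) + X c ^ n * X d := by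
    rw [twoHandles, map_add, map_mul, map_pow, map_mul, map_pow,
      twist_X_of_mem Ξ (show a ∈ ({a, b} : Finset (Fin N)) by simp),
      twist_X_of_mem Ξ (show b ∈ ({a, b} : Finset (Fin N)) by simp),
      twist_X_of_not_mem Ξ (show c ∉ ({a, b} : Finset (Fin N)) by simp [hac.symm, hbc.symm]),
      twist_X_of_not_mem Ξ (show d ∉ ({a, b} : Finset (Fin N)) by simp [had.symm, hbd.symm])]
  have h := (mem_invarianceSpace_iff k).1 hw _ (Set.mem_singleton _)
  rw [hF] at h
  simp only [map_add, map_mul, map_pow, rename_X, translate_X_some, hwa, hwb, C_0, zero_mul, add_zero] at h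
  -- h : (Y_a + Ξ_a(U + wT))^m (Y_b + Ξ_b(U + wT)) + (Y_c + w_c T)^n (Y_d + w_d T)
  --       = (Y_a + Ξ_a(U))^m (Y_b + Ξ_b(U)) + Y_c^n Y_d
  -- everything except `Y_a, Y_b` lives in `k[X_s]`, `s = {v ≠ Y_a, Y_b}`
  set s : Set (Option (Fin N)) := {v | v ≠ some a ∧ v ≠ some b} with hs
  have hmem_s : ∀ v, v ∈ s ↔ v ≠ some a ∧ v ≠ some b := fun v => Iff.rfl
  have hXmem : ∀ v : Option (Fin N), v ≠ some a → v ≠ some b →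
      (X v : MvPolynomial (Option (Fin N)) k) ∈ supported k s :=
    fun v h1 h2 => X_mem_supported.2 ((hmem_s v).2 ⟨h1, h2⟩)
  have hCmem : ∀ r : k, (C r : MvPolynomial (Option (Fin N)) k) ∈ supported k s := fun r => by
    rw [← MvPolynomial.algebraMap_eq]; exact Subalgebra.algebraMap_mem _ r
  have hren : ∀ P : MvPolynomial (Fin N) k, (∀ D ∈ P.support, D a = 0 ∧ D b = 0) →
      rename some P ∈ supported k s := by
    intro P hP
    rw [mem_supported]
    intro v hv
    obtain ⟨y, hy, rfl⟩ := Finset.mem_image.1 (vars_rename some P (Finset.mem_coe.1 hv))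
    obtain ⟨D, hD, hyD⟩ := (mem_vars_iff_mem_support y).1 hy
    have hDy : D y ≠ 0 := Finsupp.mem_support_iff.1 hyD
    refine (hmem_s _).2 ⟨fun hya => ?_, fun hyb => ?_⟩
    · rw [Option.some_injective _ hya] at hDy
      exact hDy (hP D hD).1
    · rw [Option.some_injective _ hyb] at hDy
      exact hDy (hP D hD).2
  have hTmem : ∀ P ∈ supported k s, translate k w P ∈ supported k s := by
    intro P hP
    have hT : translate k w P =
        aeval (fun o : Option (Fin N) => o.elim (X none) fun x => X (some x) + C (w x) * X none) P := rfl
    rw [hT]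
    refine aeval_mem_of_mem_supported₁₂ _ (fun v hv => ?_) hP
    obtain ⟨hva, hvb⟩ := (hmem_s v).1 hv
    cases v with
    | none => exact hXmem none (hns a) (hns b)
    | some x => exact add_mem (hXmem _ hva hvb) (mul_mem (hCmem _) (hXmem _ (hns a) (hns b)))
  have hΞas : rename some (Ξ a) ∈ supported k s := hren _ hΞa
  have hΞbs : rename some (Ξ b) ∈ supported k s := hren _ hΞb
  have hΘas : translate k w (rename some (Ξ a)) ∈ supported k s := hTmem _ hΞas
  have hΘbs : translate k w (rename some (Ξ b)) ∈ supported k s := hTmem _ hΞbs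
  set Ξa : MvPolynomial (Option (Fin N)) k := rename some (Ξ a) with hΞa'
  set Ξb : MvPolynomial (Option (Fin N)) k := rename some (Ξ b) with hΞb'
  set Θa : MvPolynomial (Option (Fin N)) k := translate k w Ξa with hΘa
  set Θb : MvPolynomial (Option (Fin N)) k := translate k w Ξb with hΘb
  have hHws : ((X (some c) + C (w c) * X none) ^ n * (X (some d) + C (w d) * X none) :
      MvPolynomial (Option (Fin N)) k) ∈ supported k s :=
    mul_mem (pow_mem (add_mem (hXmem _ (hne hac.symm) (hne hbc.symm))
      (mul_mem (hCmem _) (hXmem _ (hns a) (hns b)))) n)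
      (add_mem (hXmem _ (hne had.symm) (hne hbd.symm)) (mul_mem (hCmem _) (hXmem _ (hns a) (hns b))))
  have hH0s : (X (some c) ^ n * X (some d) : MvPolynomial (Option (Fin N)) k) ∈ supported k s :=
    mul_mem (pow_mem (hXmem _ (hne hac.symm) (hne hbc.symm)) n) (hXmem _ (hne had.symm) (hne hbd.symm))
  -- the shift `Y_a ↦ Y_a - Ξa`, `Y_b ↦ Y_b - Ξb`
  obtain ⟨σ, hσa, hσb, hσfix⟩ : ∃ σ : MvPolynomial (Option (Fin N)) k →ₐ[k] MvPolynomial (Option (Fin N)) k,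
      σ (X (some a)) = X (some a) - Ξa ∧ σ (X (some b)) = X (some b) - Ξb ∧
        ∀ P ∈ supported k s, σ P = P := by
    refine ⟨aeval fun v => if v = some a then X (some a) - Ξa else if v = some b then X (some b) - Ξb else X v,
      ?_, ?_, fun P hP => aeval_eq_self_of_mem_supported₁₂ _ (fun v hv => ?_) hP⟩
    · rw [aeval_X, if_pos rfl]
    · rw [aeval_X, if_neg (hne hab.symm), if_pos rfl]
    · obtain ⟨hva, hvb⟩ := (hmem_s v).1 hv
      rw [if_neg hva, if_neg hvb]
  have h2 := congrArg σ h
  simp only [map_add, map_mul, map_pow, hσa, hσb, hσfix _ hΘas, hσfix _ hΘbs, hσfix _ hΞas, hσfix _ hΞbs,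
    hσfix _ hHws, hσfix _ hH0s, sub_add_cancel] at h2
  set Da : MvPolynomial (Option (Fin N)) k := Θa - Ξa with hDa
  have hDas : Da ∈ supported k s := sub_mem hΘas hΞas
  have hDbs : Θb - Ξb ∈ supported k s := sub_mem hΘbs hΞbs
  rw [show X (some a) - Ξa + Θa = X (some a) + Da by rw [hDa]; ring,
    show X (some b) - Ξb + Θb = X (some b) + (Θb - Ξb) by ring] at h2
  -- h2 : (Y_a + D_a)^m (Y_b + D_b) + H_w = Y_a^m Y_b + H_0
  have hκa : ∀ P ∈ supported k s, killVar (some a) P = P := fun P hP =>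
    aeval_eq_self_of_mem_supported₁₂ _ (fun v hv => if_neg ((hmem_s v).1 hv).1) hP
  have hκb : ∀ P ∈ supported k s, killVar (some b) P = P := fun P hP =>
    aeval_eq_self_of_mem_supported₁₂ _ (fun v hv => if_neg ((hmem_s v).1 hv).2) hP
  -- kill `Y_a`
  have h3 := congrArg (killVar (some a)) h2
  simp only [map_add, map_mul, map_pow, killVar_X, if_true, hne hab.symm, if_false, hκa _ hDas,
    hκa _ hDbs, hκa _ hHws, hκa _ hH0s, zero_add, zero_pow hm0, zero_mul] at h3
  -- h3 : D_a^m (Y_b + D_b) + H_w = H_0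
  -- kill `Y_b` as well
  have h4 := congrArg (killVar (some b)) h3
  simp only [map_add, map_mul, map_pow, killVar_X, if_true, hκb _ hDas, hκb _ hDbs, hκb _ hHws,
    hκb _ hH0s, zero_add] at h4
  -- h4 : D_a^m D_b + H_w = H_0
  have h5 : Da ^ m * X (some b) = 0 := by linear_combination h3 - h4
  have hDa0 : Da = 0 := by
    rcases mul_eq_zero.1 h5 with h5 | h5
    · exact (pow_eq_zero_iff hm0).1 h5
    · exact absurd h5 (X_ne_zero _)
  rw [hDa0, zero_pow hm0, zero_mul, zero_add] at h3
  -- h3 : H_w = H_0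
  exact eq_zero_of_translate_handle₁₂ hcd hn h3

/-- A direction off `X_a, X_b, X_c, X_d` leaves `X_a^m X_b + X_c^n X_d` invariant (plumbing).
[cite: CossartJannsenSaito2020, Def. 1.26 / Lemma 1.27] -/
theorem mem_invarianceSpace_twoHandles {w : Fin N → k} (hwa : w a = 0) (hwb : w b = 0) (hwc : w c = 0)
    (hwd : w d = 0) : w ∈ invarianceSpace k {twoHandles k a b c d m n} := by
  refine (mem_invarianceSpace_iff k).2 fun F hF => ?_
  rw [Set.mem_singleton_iff] at hF
  subst hF
  simp only [twoHandles, map_add, map_mul, map_pow, rename_X, translate_X_some, hwa, hwb, hwc, hwd, C_0,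
    zero_mul, add_zero]

/-! ## §5 The maximum `(m+1, m+1, n+1, n+1)` -/

/-- **`(m+1, m+1, n+1, n+1) ∈ W(X_a^m X_b + X_c^n X_d)`** (`m ≤ n`): the coordinate centre with weights
`(1/(m+1), 1/(m+1), 1/(n+1), 1/(n+1))` on `(X_a, X_b, X_c, X_d)`. (derived here, from `familyExps_mem`)
[cite: AbramovichTemkinWlodarczyk2024, Lemma 5.2.6 (p. 1576), §5.1 (p. 1575)] -/
theorem twoHandles_inv_mem (hab : a ≠ b) (hac : a ≠ c) (had : a ≠ d) (hbc : b ≠ c) (hbd : b ≠ d)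
    (hcd : c ≠ d) (hmn : m ≤ n) :
    [((m + 1 : ℕ) : ℚ), ((m + 1 : ℕ) : ℚ), ((n + 1 : ℕ) : ℚ), ((n + 1 : ℕ) : ℚ)] ∈
      admissibleInvariants (twoHandles k a b c d m n) := by
  classical
  have h := familyExps_mem (k := k) [] [(a, m, b), (c, n, d)] (by simp)
    (by simp [hab, hac, had, hbc.symm, hbd, hcd])
  have hf : pureHandle (k := k) [] [(a, m, b), (c, n, d)] = twoHandles k a b c d m n := by
    simp [pureHandle, twoHandles]
  have hle : (m : ℚ) + 1 ≤ (n : ℚ) + 1 := by exact_mod_cast Nat.succ_le_succ hmn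
  have hexps : familyExps [] [(a, m, b), (c, n, d)] =
      [((m + 1 : ℕ) : ℚ), ((m + 1 : ℕ) : ℚ), ((n + 1 : ℕ) : ℚ), ((n + 1 : ℕ) : ℚ)] := by
    simp [familyExps, List.insertionSort, hle]
  rw [hf, hexps] at h
  exact h

/-- Every non-zero weight contributes its inverse to `exps` (plumbing). [folklore] -/
private theorem inv_mem_exps_of_ne_zero₁₂ {γ : Fin N → ℚ} {x : Fin N} (hx : γ x ≠ 0) : (γ x)⁻¹ ∈ exps γ := by
  classical
  unfold exps
  rw [List.mem_insertionSort, List.mem_map]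
  exact ⟨x, Finset.mem_toList.2 (Finset.mem_filter.2 ⟨Finset.mem_univ _, hx⟩), rfl⟩

/-- The head of a sorted list is its minimum (plumbing). [folklore] -/
private theorem le_of_mem_of_pairwise₁₂ {c x : ℚ} {es : List ℚ} (hs : (c :: es).Pairwise (· ≤ ·))
    (hx : x ∈ c :: es) : c ≤ x := by
  rcases List.mem_cons.1 hx with rfl | hx
  · exact le_rfl
  · exact (List.pairwise_cons.1 hs).1 x hx

/-- A sorted list with an entry `≤ θ` starts with one (plumbing). [folklore] -/
private theorem head_le_of_countP_pos₁₂ {θ e : ℚ} {es : List ℚ} (hs : (e :: es).Pairwise (· ≤ ·))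
    (h : 0 < (e :: es).countP fun x => decide (x ≤ θ)) : e ≤ θ := by
  obtain ⟨x, hx, hxθ⟩ := List.countP_pos_iff.1 h
  exact (le_of_mem_of_pairwise₁₂ hs hx).trans (by simpa using hxθ)

/-- Order bookkeeping for `[M, M, θ, θ]`: a smaller third entry (plumbing). [folklore] -/
private theorem not_lt_quad_of_third_lt₁₂ {M θ e₃ : ℚ} {rest : List ℚ} (h : e₃ < θ) :
    ¬ ATW.TruncLex.lt [M, M, θ, θ] (M :: M :: e₃ :: rest) := by
  rw [ATW.TruncLex.cons_lt_cons, ATW.TruncLex.cons_lt_cons, ATW.TruncLex.cons_lt_cons]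
  rintro (h1 | ⟨-, h2 | ⟨-, h3 | ⟨h4, -⟩⟩⟩)
  · exact lt_irrefl _ h1
  · exact lt_irrefl _ h2
  · exact lt_asymm h h3
  · exact h.ne' h4

/-- Order bookkeeping for `[M, M, θ, θ]`: a fourth entry `≤ θ` (plumbing). [folklore] -/
private theorem not_lt_quad_of_fourth_le₁₂ {M θ e₄ : ℚ} {rest : List ℚ} (h : e₄ ≤ θ) :
    ¬ ATW.TruncLex.lt [M, M, θ, θ] (M :: M :: θ :: e₄ :: rest) := by
  rw [ATW.TruncLex.cons_lt_cons, ATW.TruncLex.cons_lt_cons, ATW.TruncLex.cons_lt_cons,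
    ATW.TruncLex.cons_lt_cons]
  rintro (h1 | ⟨-, h2 | ⟨-, h3 | ⟨-, h4 | ⟨-, h5⟩⟩⟩⟩)
  · exact lt_irrefl _ h1
  · exact lt_irrefl _ h2
  · exact lt_irrefl _ h3
  · exact not_lt.2 h h4
  · exact ATW.TruncLex.not_nil_lt _ h5

/-- Counting bookkeeping for the variables of weight `≥ 1/Q` (plumbing). [folklore] -/
private theorem card_add_card_le_card_filter₁₂ {γ : Fin N → ℚ} {S : Finset (Fin N)} {P Q : ℚ} (hP : 0 < P)
    (hPQ : P ≤ Q) (hQ : 0 < Q) (hγS : ∀ x ∈ S, γ x = P⁻¹) :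
    S.card + (Finset.univ.filter fun x => x ∉ S ∧ γ x = Q⁻¹).card ≤
      (Finset.univ.filter fun x => γ x ≠ 0 ∧ (γ x)⁻¹ ≤ Q).card := by
  classical
  rw [← Finset.card_union_of_disjoint
    (Finset.disjoint_left.2 fun x hxS hxB => (Finset.mem_filter.1 hxB).2.1 hxS)]
  refine Finset.card_le_card fun x hx => ?_
  rw [Finset.mem_filter]
  refine ⟨Finset.mem_univ _, ?_⟩
  rcases Finset.mem_union.1 hx with hx | hx
  · rw [hγS x hx, inv_inv]; exact ⟨inv_ne_zero hP.ne', hPQ⟩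
  · rw [(Finset.mem_filter.1 hx).2.2, inv_inv]; exact ⟨inv_ne_zero hQ.ne', le_rfl⟩

/-- Two swaps move `(a, b)` to `(x₀, x₁)` (plumbing). [folklore] -/
private theorem exists_perm_pair₁₂ {x₀ x₁ : Fin N} (hab : a ≠ b) (h01 : x₀ ≠ x₁) :
    ∃ π : Equiv.Perm (Fin N), π a = x₀ ∧ π b = x₁ := by
  classical
  refine ⟨(Equiv.swap a x₀).trans (Equiv.swap (Equiv.swap a x₀ b) x₁), ?_, ?_⟩
  · have hb : Equiv.swap a x₀ b ≠ x₀ := by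
      intro h
      have h' := congrArg (Equiv.swap a x₀) h
      rw [Equiv.swap_apply_self, Equiv.swap_apply_right] at h'
      exact hab h'.symm
    rw [Equiv.trans_apply, Equiv.swap_apply_left, Equiv.swap_apply_of_ne_of_ne hb.symm h01]
  · rw [Equiv.trans_apply, Equiv.swap_apply_left]

/-- **First face and exhaustion of twists: nothing in `W(X_a^m X_b + X_c^n X_d)` is above
`(m+1, m+1, n+1, n+1)`** (`a, b, c, d` pairwise distinct, `1 ≤ m < n`, every field, spectators allowed, all
polynomial coordinate changes): small weights give the prefix `(m+1, m+1)` (`τ = 2`) and, by `δ`-preparedness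
(no vertex), a third entry `≤ (m+1)δ = n+1`; if the third entry equals `n+1`, the two variables of weight `1/(m+1)`
are moved to `(a, b)` by a permutation and the exhaustion-of-twists count (`τ(f) = 4`) gives a fourth entry
`≤ n+1`; a weight `> 1/(m+1)` gives a head `< m+1`. (derived here, from the vertex theorems of
`WeightedCentreVertexPreparation` and `WeightedCentreTwistExhaustion`)
[cite: AbramovichTemkinWlodarczyk2024, Thm. 5.3.1 (2) (p. 1578)] [cite: CossartJannsenSaito2020, Thm. 8.16 (p. 121), Thm. 8.22 (a) (p. 124)] -/
theorem not_lt_of_mem_admissibleInvariants_twoHandles (hab : a ≠ b) (hac : a ≠ c) (had : a ≠ d)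
    (hbc : b ≠ c) (hbd : b ≠ d) (hcd : c ≠ d) (hm : 1 ≤ m) (hmn : m < n) {l : List ℚ}
    (hl : l ∈ admissibleInvariants (twoHandles k a b c d m n)) :
    ¬ ATW.TruncLex.lt [((m + 1 : ℕ) : ℚ), ((m + 1 : ℕ) : ℚ), ((n + 1 : ℕ) : ℚ), ((n + 1 : ℕ) : ℚ)] l := by
  classical
  have hn : 1 ≤ n := hm.trans hmn.le
  have hM0 : (0 : ℚ) < ((m + 1 : ℕ) : ℚ) := by positivity
  have hN0 : (0 : ℚ) < ((n + 1 : ℕ) : ℚ) := by positivity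
  have hMN : ((m + 1 : ℕ) : ℚ) < ((n + 1 : ℕ) : ℚ) := by exact_mod_cast Nat.succ_lt_succ hmn
  have hMδ : ((m + 1 : ℕ) : ℚ) * (((n + 1 : ℕ) : ℚ) / ((m + 1 : ℕ) : ℚ)) = ((n + 1 : ℕ) : ℚ) := by
    field_simp
  set f := twoHandles k a b c d m n
  -- the inputs of the vertex theorems
  have hord : monomialOrd (fun _ => 1) f = ((m + 1 : ℕ) : ℕ∞) := monomialOrd_twoHandles had hbd hcd hmn.le
  have hin : homogeneousComponent (m + 1) f = X a ^ m * X b := homogeneousComponent_twoHandles hmn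
  have hτ : ({a, b} : Finset (Fin N)).card = hironakaTau k {homogeneousComponent (m + 1) f} := by
    rw [hin, hironakaTau_X_pow_mul_X hab hm, Finset.card_pair hab]
  have hFS := hFS_twoHandles (k := k) (a := a) (b := b) (c := c) (d := d) hmn
  have hδ : hironakaDelta {a, b} (m + 1) f = (((((n + 1 : ℕ) : ℚ) / ((m + 1 : ℕ) : ℚ)) : ℚ) : WithTop ℚ) :=
    hironakaDelta_twoHandles hac had hbc hbd hcd
  have hprep : IsDeltaPrepared {a, b} (m + 1) f := isDeltaPrepared_twoHandles hac had hbc hbd hcd hm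
  have hinδ : deltaInitial {a, b} (m + 1) (((n + 1 : ℕ) : ℚ) / ((m + 1 : ℕ) : ℚ)) f = f :=
    deltaInitial_twoHandles hac had hbc hbd hcd
  have hτδ : hironakaTau k {deltaInitial {a, b} (m + 1) (((n + 1 : ℕ) : ℚ) / ((m + 1 : ℕ) : ℚ)) f} = 4 := by
    rw [hinδ]; exact hironakaTau_twoHandles hab hac had hbc hbd hcd hm hn
  -- exhaustion of twists: no degree-`δ` twist of `(Y_a, Y_b)` hides a `u`-direction
  have hcount : ∀ w : Fin N → k, (∀ x ∈ ({a, b} : Finset (Fin N)), w x = 0) →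
      w ∉ invarianceSpace k {deltaInitial {a, b} (m + 1) (((n + 1 : ℕ) : ℚ) / ((m + 1 : ℕ) : ℚ)) f} →
      ∀ Ξ : Fin N → MvPolynomial (Fin N) k,
        (∀ x ∈ ({a, b} : Finset (Fin N)), ∀ D ∈ (Ξ x).support,
          blockDeg {a, b} D = 0 ∧ (D.degree : ℚ) = ((n + 1 : ℕ) : ℚ) / ((m + 1 : ℕ) : ℚ)) →
        w ∉ invarianceSpace k
          {twist {a, b} Ξ (deltaInitial {a, b} (m + 1) (((n + 1 : ℕ) : ℚ) / ((m + 1 : ℕ) : ℚ)) f)} := by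
    intro w hwS hwW Ξ hΞ hwT
    rw [hinδ] at hwW hwT
    have hwa : w a = 0 := hwS a (by simp)
    have hwb : w b = 0 := hwS b (by simp)
    have hΞ' : ∀ x ∈ ({a, b} : Finset (Fin N)), ∀ D ∈ (Ξ x).support, D a = 0 ∧ D b = 0 := by
      intro x hx D hD
      have h0 := (hΞ x hx D hD).1
      exact ⟨apply_eq_zero_of_blockDeg_eq_zero₁₂ h0 a (by simp),
        apply_eq_zero_of_blockDeg_eq_zero₁₂ h0 b (by simp)⟩
    obtain ⟨hwc, hwd⟩ := eq_zero_of_mem_invarianceSpace_twist_twoHandles hab hac had hbc hbd hcd hm hn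
      hwa hwb (hΞ' a (by simp)) (hΞ' b (by simp)) hwT
    exact hwW (mem_invarianceSpace_twoHandles hwa hwb hwc hwd)
  obtain ⟨Ψ, γ, h, rfl⟩ := hl
  have hsorted := exps_sorted γ
  have hγpos : ∀ x, γ x ≠ 0 → 0 < γ x := fun x hx => lt_of_le_of_ne (h.2.1 x) (Ne.symm hx)
  by_cases hle : ∀ x, γ x ≤ (((m + 1 : ℕ) : ℚ))⁻¹
  · -- `[m+1, m+1]` is a prefix of `exps γ`, and at least three entries are `≤ n+1`
    obtain ⟨es, hes⟩ : ∃ es, exps γ = ((m + 1 : ℕ) : ℚ) :: ((m + 1 : ℕ) : ℚ) :: es := by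
      obtain ⟨t, ht⟩ := replicate_prefix_of_forall_le hord h hle
      rw [← hτ, Finset.card_pair hab] at ht
      exact ⟨t, by simpa [List.replicate] using ht.symm⟩
    have hcount3 := succ_card_le_countP_exps_of_isDeltaPrepared hord hτ hFS hprep hδ h hle
    rw [Finset.card_pair hab, hMδ, hes, List.countP_cons_of_pos (by simpa using hMN.le),
      List.countP_cons_of_pos (by simpa using hMN.le)] at hcount3
    rw [hes] at hsorted
    obtain ⟨e₃, es', rfl⟩ : ∃ e₃ es', es = e₃ :: es' := by
      cases es with
      | nil => simp at hcount3
      | cons e₃ es' => exact ⟨e₃, es', rfl⟩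
    have hs₃ : (e₃ :: es').Pairwise (· ≤ ·) :=
      (List.pairwise_cons.1 (List.pairwise_cons.1 hsorted).2).2
    have he₃ : e₃ ≤ ((n + 1 : ℕ) : ℚ) := head_le_of_countP_pos₁₂ hs₃ (by omega)
    rw [hes]
    by_cases heq₃ : e₃ = ((n + 1 : ℕ) : ℚ)
    swap
    · exact not_lt_quad_of_third_lt₁₂ (lt_of_le_of_ne he₃ heq₃)
    subst heq₃
    -- exactly two entries of `exps γ` are `≤ m+1`: the variables `x₀, x₁` of weight `1/(m+1)`
    have hes' : ∀ x ∈ es', ((n + 1 : ℕ) : ℚ) ≤ x := (List.pairwise_cons.1 hs₃).1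
    have hcountM : (exps γ).countP (fun x => decide (x ≤ ((m + 1 : ℕ) : ℚ))) = 2 := by
      rw [hes, List.countP_cons_of_pos (by simp), List.countP_cons_of_pos (by simp),
        List.countP_cons_of_neg (by simpa using hMN),
        List.countP_eq_zero.2 fun x hx => by simpa using hMN.trans_le (hes' x hx)]
    rw [countP_exps] at hcountM
    obtain ⟨x₀, x₁, hx01, hA⟩ := Finset.card_eq_two.1 hcountM
    have hmemA : ∀ x, x ∈ ({x₀, x₁} : Finset (Fin N)) ↔ γ x ≠ 0 ∧ (γ x)⁻¹ ≤ ((m + 1 : ℕ) : ℚ) := by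
      intro x
      rw [← hA, Finset.mem_filter]
      exact ⟨fun h => h.2, fun h => ⟨Finset.mem_univ _, h⟩⟩
    have hγA : ∀ x ∈ ({x₀, x₁} : Finset (Fin N)), γ x = (((m + 1 : ℕ) : ℚ))⁻¹ := by
      intro x hx
      obtain ⟨h0, hxM⟩ := (hmemA x).1 hx
      exact le_antisymm (hle x) (inv_le_of_inv_le₀ (hγpos x h0) hxM)
    have hothers : ∀ x, x ∉ ({x₀, x₁} : Finset (Fin N)) → γ x ≤ (((n + 1 : ℕ) : ℚ))⁻¹ := by
      intro x hx
      by_cases h0 : γ x = 0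
      · rw [h0]; exact inv_nonneg.2 hN0.le
      have hnot : ¬ (γ x)⁻¹ ≤ ((m + 1 : ℕ) : ℚ) := fun hle' => hx ((hmemA x).2 ⟨h0, hle'⟩)
      have hmem := inv_mem_exps_of_ne_zero₁₂ h0
      rw [hes, List.mem_cons, List.mem_cons] at hmem
      rcases hmem with heq | heq | hmem
      · exact absurd heq.le hnot
      · exact absurd heq.le hnot
      · exact le_inv_of_le_inv₀ hN0 (le_of_mem_of_pairwise₁₂ hs₃ hmem)
    -- move `(x₀, x₁)` to `(a, b)` and count the variables of weight exactly `1/(n+1)`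
    obtain ⟨π, hπa, hπb⟩ := exists_perm_pair₁₂ (a := a) (b := b) hab hx01
    have hπS : ∀ x, x ∉ ({a, b} : Finset (Fin N)) → π x ∉ ({x₀, x₁} : Finset (Fin N)) := by
      intro x hx hπx
      apply hx
      rw [Finset.mem_insert, Finset.mem_singleton] at hπx ⊢
      rcases hπx with h1 | h1
      · exact Or.inl (π.injective (h1.trans hπa.symm))
      · exact Or.inr (π.injective (h1.trans hπb.symm))
    have h' := h.perm π
    have hγS : ∀ x ∈ ({a, b} : Finset (Fin N)), (γ ∘ π) x = (((m + 1 : ℕ) : ℚ))⁻¹ := by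
      intro x hx
      rw [Finset.mem_insert, Finset.mem_singleton] at hx
      rw [Function.comp_apply]
      rcases hx with hx | hx
      · rw [hx, hπa]; exact hγA x₀ (by simp)
      · rw [hx, hπb]; exact hγA x₁ (by simp)
    have hγle : ∀ x ∉ ({a, b} : Finset (Fin N)),
        (γ ∘ π) x ≤ (((m + 1 : ℕ) : ℚ) * (((n + 1 : ℕ) : ℚ) / ((m + 1 : ℕ) : ℚ)))⁻¹ := by
      intro x hx
      rw [hMδ, Function.comp_apply]
      exact hothers _ (hπS x hx)
    have hbound := hironakaTau_deltaInitial_le_of_forall_twist hord hτ hFS hprep hδ hcount h' hγS hγle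
    rw [hτδ, Finset.card_pair hab, hMδ] at hbound
    -- hbound : 4 ≤ 2 + #{x ∉ {a, b} : γ (π x) = 1/(n+1)}
    have hcnt : 4 ≤ (exps (γ ∘ π)).countP (fun x => decide (x ≤ ((n + 1 : ℕ) : ℚ))) := by
      have h2 := card_add_card_le_card_filter₁₂ hM0 hMN.le hN0 hγS
      rw [Finset.card_pair hab] at h2
      rw [countP_exps]
      exact hbound.trans h2
    rw [exps_comp_perm, hes, List.countP_cons_of_pos (by simpa using hMN.le),
      List.countP_cons_of_pos (by simpa using hMN.le), List.countP_cons_of_pos (by simp)] at hcnt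
    cases es' with
    | nil => simp at hcnt
    | cons e₄ es'' =>
      have hs₄ : (e₄ :: es'').Pairwise (· ≤ ·) := (List.pairwise_cons.1 hs₃).2
      exact not_lt_quad_of_fourth_le₁₂ (head_le_of_countP_pos₁₂ hs₄ (by omega))
  · -- some weight exceeds `1/(m+1)`: the head of `exps γ` is `< m+1`
    push Not at hle
    obtain ⟨x, hx⟩ := hle
    have hγx : γ x ≠ 0 := (lt_trans (inv_pos.2 hM0) hx).ne'
    have hlt : (γ x)⁻¹ < ((m + 1 : ℕ) : ℚ) := inv_lt_of_inv_lt₀ hM0 hx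
    have hmem := inv_mem_exps_of_ne_zero₁₂ hγx
    obtain ⟨e, es, hes⟩ : ∃ e es, exps γ = e :: es := by
      cases hq : exps γ with
      | nil => rw [hq] at hmem; simp at hmem
      | cons e es => exact ⟨e, es, rfl⟩
    rw [hes] at hmem hsorted ⊢
    have he : e < ((m + 1 : ℕ) : ℚ) := (le_of_mem_of_pairwise₁₂ hsorted hmem).trans_lt hlt
    rw [ATW.TruncLex.cons_lt_cons]
    rintro (h1 | ⟨h2, -⟩)
    · exact lt_asymm he h1
    · exact he.ne' h2

/-- **`max W(X_a^m X_b + X_c^n X_d) = (m+1, m+1, n+1, n+1)`** for pairwise distinct `a, b, c, d` and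
`1 ≤ m < n`, in EVERY field: the coordinate centre realises the invariant, maximised over ALL admissible centres
after ALL polynomial coordinate changes, spectator variables allowed. (derived here)
[cite: AbramovichTemkinWlodarczyk2024, Thm. 5.3.1 (2)–(3) (p. 1578)] [cite: CossartJannsenSaito2020, Thm. 8.16 (p. 121), Thm. 8.22 (a) (p. 124)] -/
theorem isMaxInv_twoHandles (hab : a ≠ b) (hac : a ≠ c) (had : a ≠ d) (hbc : b ≠ c) (hbd : b ≠ d)
    (hcd : c ≠ d) (hm : 1 ≤ m) (hmn : m < n) :
    IsMaxInv (admissibleInvariants (twoHandles k a b c d m n))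
      [((m + 1 : ℕ) : ℚ), ((m + 1 : ℕ) : ℚ), ((n + 1 : ℕ) : ℚ), ((n + 1 : ℕ) : ℚ)] :=
  ⟨twoHandles_inv_mem hab hac had hbc hbd hcd hmn.le,
    fun _ hl => not_lt_of_mem_admissibleInvariants_twoHandles hab hac had hbc hbd hcd hm hmn hl⟩

/-- **The homogeneous case: `max W(X_a^m X_b + X_c^m X_d) = (m+1, m+1, m+1, m+1)`** for pairwise distinct
`a, b, c, d` and `1 ≤ m`, every characteristic: the polynomial is its own initial form and `τ = 4`
(`hironakaTau_twoHandles`), so the coordinate centre is maximal (`isMaxInv_replicate_of_mem`). (derived here)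
[cite: AbramovichTemkinWlodarczyk2024, Thm. 5.3.1 (2)–(3) (p. 1578)] [cite: CossartJannsenSaito2020, Def. 1.26 / Lemma 1.27] -/
theorem isMaxInv_twoHandles_self (hab : a ≠ b) (hac : a ≠ c) (had : a ≠ d) (hbc : b ≠ c) (hbd : b ≠ d)
    (hcd : c ≠ d) (hm : 1 ≤ m) :
    IsMaxInv (admissibleInvariants (twoHandles k a b c d m m))
      [((m + 1 : ℕ) : ℚ), ((m + 1 : ℕ) : ℚ), ((m + 1 : ℕ) : ℚ), ((m + 1 : ℕ) : ℚ)] := by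
  have hmem := twoHandles_inv_mem (k := k) hab hac had hbc hbd hcd (le_refl m)
  have hhom : (twoHandles k a b c d m m).IsHomogeneous (m + 1) :=
    (isHomogeneous_X_pow_mul_X₁₂ a b m).add (isHomogeneous_X_pow_mul_X₁₂ c d m)
  have hτ : hironakaTau k {homogeneousComponent (m + 1) (twoHandles k a b c d m m)} = 4 := by
    rw [homogeneousComponent_of_mem hhom, if_pos rfl]
    exact hironakaTau_twoHandles hab hac had hbc hbd hcd hm hm
  have h := isMaxInv_replicate_of_mem (f := twoHandles k a b c d m m) (ν := m + 1)
    (monomialOrd_twoHandles had hbd hcd le_rfl) (by rw [hτ]; exact hmem)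
  rw [hτ] at h
  exact h

/-- **The two-handle family law `max W(X_a^m X_b + X_c^n X_d) = (min+1, min+1, max+1, max+1)` in EVERY
characteristic** (`a, b, c, d` pairwise distinct, `m, n ≥ 1`, any number of spectator variables): the census's
`{handle, handle}` block pair (engine 1, C136 (d)) with the regimes `m < n` (`isMaxInv_twoHandles`), `m = n`
(`isMaxInv_twoHandles_self`) and `m > n` (symmetry `twoHandles_swap`) glued. (derived here)
[cite: AbramovichTemkinWlodarczyk2024, Thm. 5.3.1 (2)–(3) (p. 1578)] [cite: CossartJannsenSaito2020, Thm. 8.16 (p. 121)] -/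
theorem isMaxInv_twoHandles_law (hab : a ≠ b) (hac : a ≠ c) (had : a ≠ d) (hbc : b ≠ c) (hbd : b ≠ d)
    (hcd : c ≠ d) (hm : 1 ≤ m) (hn : 1 ≤ n) :
    IsMaxInv (admissibleInvariants (twoHandles k a b c d m n))
      (if m ≤ n then [((m + 1 : ℕ) : ℚ), ((m + 1 : ℕ) : ℚ), ((n + 1 : ℕ) : ℚ), ((n + 1 : ℕ) : ℚ)]
        else [((n + 1 : ℕ) : ℚ), ((n + 1 : ℕ) : ℚ), ((m + 1 : ℕ) : ℚ), ((m + 1 : ℕ) : ℚ)]) := by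
  split_ifs with h
  · rcases Nat.lt_or_eq_of_le h with h' | h'
    · exact isMaxInv_twoHandles hab hac had hbc hbd hcd hm h'
    · subst h'
      exact isMaxInv_twoHandles_self hab hac had hbc hbd hcd hm
  · rw [twoHandles_swap]
    exact isMaxInv_twoHandles hcd (Ne.symm hac) (Ne.symm hbc) (Ne.symm had) (Ne.symm hbd) hab hn (by omega)

/-- The law, unfolded: `max W(X_a^m X_b + X_c^n X_d) = (min+1, min+1, max+1, max+1)` for `m, n ≥ 1` and
`a, b, c, d` pairwise distinct, every field. (derived here) [cite: AbramovichTemkinWlodarczyk2024, Thm. 5.3.1 (2)–(3) (p. 1578)] -/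
theorem isMaxInv_X_pow_mul_X_add_X_pow_mul_X (hab : a ≠ b) (hac : a ≠ c) (had : a ≠ d) (hbc : b ≠ c)
    (hbd : b ≠ d) (hcd : c ≠ d) (hm : 1 ≤ m) (hn : 1 ≤ n) :
    IsMaxInv (admissibleInvariants (X a ^ m * X b + X c ^ n * X d : MvPolynomial (Fin N) k))
      (if m ≤ n then [(m : ℚ) + 1, (m : ℚ) + 1, (n : ℚ) + 1, (n : ℚ) + 1]
        else [(n : ℚ) + 1, (n : ℚ) + 1, (m : ℚ) + 1, (m : ℚ) + 1]) := by
  have h := isMaxInv_twoHandles_law (k := k) hab hac had hbc hbd hcd hm hn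
  rw [twoHandles] at h
  push_cast at h
  exact h

/-- **C136 (d) for two handles, in the family's own language**: `max W(pureHandle [] [(a,m,b),(c,n,d)]) =
familyExps [] [(a,m,b),(c,n,d)] = sort (m+1, m+1, n+1, n+1)` for `m, n ≥ 1`, `a, b, c, d` pairwise distinct,
every field (the census's family law, engine 1, FE33 C136 (d), block types `{handle, handle}`). (derived here)
[cite: AbramovichTemkinWlodarczyk2024, Thm. 5.3.1 (2)–(3) (p. 1578), §5.1 (p. 1575)] -/
theorem isMaxInv_pureHandle_pair (hab : a ≠ b) (hac : a ≠ c) (had : a ≠ d) (hbc : b ≠ c) (hbd : b ≠ d)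
    (hcd : c ≠ d) (hm : 1 ≤ m) (hn : 1 ≤ n) :
    IsMaxInv (admissibleInvariants (pureHandle (k := k) [] [(a, m, b), (c, n, d)]))
      (familyExps [] [(a, m, b), (c, n, d)]) := by
  have hf : pureHandle (k := k) [] [(a, m, b), (c, n, d)] = X a ^ m * X b + X c ^ n * X d := by
    simp [pureHandle]
  have h := isMaxInv_X_pow_mul_X_add_X_pow_mul_X (k := k) hab hac had hbc hbd hcd hm hn
  rw [hf]
  by_cases hmn : m ≤ n
  · have hle : (m : ℚ) + 1 ≤ (n : ℚ) + 1 := by exact_mod_cast Nat.succ_le_succ hmn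
    have hexps : familyExps [] [(a, m, b), (c, n, d)] = [(m : ℚ) + 1, (m : ℚ) + 1, (n : ℚ) + 1, (n : ℚ) + 1] := by
      simp [familyExps, List.insertionSort, hle]
    rw [if_pos hmn] at h
    rw [hexps]
    exact h
  · have hlt : ¬ ((m : ℚ) + 1 ≤ (n : ℚ) + 1) := by
      rw [not_le]; exact_mod_cast Nat.succ_lt_succ (not_le.1 hmn)
    have hexps : familyExps [] [(a, m, b), (c, n, d)] = [(n : ℚ) + 1, (n : ℚ) + 1, (m : ℚ) + 1, (m : ℚ) + 1] := by
      simp [familyExps, List.insertionSort, hlt]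
    rw [if_neg hmn] at h
    rw [hexps]
    exact h

/-! ## §6 Worked instances -/

/-- Two nodes' worth of handles: `x y + z w ↦ (2, 2, 2, 2)` (homogeneous, `m = n = 1`), every field.
(derived here) [cite: AbramovichTemkinWlodarczyk2024, Thm. 5.3.1 (2)–(3) (p. 1578)] -/
example : IsMaxInv (admissibleInvariants (X 0 * X 1 + X 2 * X 3 : MvPolynomial (Fin 4) k)) [2, 2, 2, 2] := by
  have h := isMaxInv_X_pow_mul_X_add_X_pow_mul_X (k := k) (N := 4) (a := 0) (b := 1) (c := 2) (d := 3)
    (m := 1) (n := 1) (by decide) (by decide) (by decide) (by decide) (by decide) (by decide) le_rfl le_rfl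
  rw [pow_one, pow_one] at h
  norm_num at h
  exact h

/-- `x y + z² w ↦ (2, 2, 3, 3)`, every field. (derived here)
[cite: AbramovichTemkinWlodarczyk2024, Thm. 5.3.1 (2)–(3) (p. 1578)] -/
example : IsMaxInv (admissibleInvariants (X 0 * X 1 + X 2 ^ 2 * X 3 : MvPolynomial (Fin 4) k)) [2, 2, 3, 3] := by
  have h := isMaxInv_X_pow_mul_X_add_X_pow_mul_X (k := k) (N := 4) (a := 0) (b := 1) (c := 2) (d := 3)
    (m := 1) (n := 2) (by decide) (by decide) (by decide) (by decide) (by decide) (by decide) le_rfl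
    (by norm_num)
  rw [pow_one] at h
  norm_num at h
  exact h

/-- `x² y + z³ w ↦ (3, 3, 4, 4)` with one spectator variable, every field. (derived here)
[cite: AbramovichTemkinWlodarczyk2024, Thm. 5.3.1 (2)–(3) (p. 1578)] -/
example : IsMaxInv (admissibleInvariants (X 0 ^ 2 * X 1 + X 2 ^ 3 * X 3 : MvPolynomial (Fin 5) k))
    [3, 3, 4, 4] := by
  have h := isMaxInv_X_pow_mul_X_add_X_pow_mul_X (k := k) (N := 5) (a := 0) (b := 1) (c := 2) (d := 3)
    (m := 2) (n := 3) (by decide) (by decide) (by decide) (by decide) (by decide) (by decide) (by norm_num)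
    (by norm_num)
  norm_num at h
  exact h

/-- The higher handle written first: `x³ y + z w ↦ (2, 2, 4, 4)`, every field. (derived here)
[cite: AbramovichTemkinWlodarczyk2024, Thm. 5.3.1 (2)–(3) (p. 1578)] -/
example : IsMaxInv (admissibleInvariants (X 0 ^ 3 * X 1 + X 2 * X 3 : MvPolynomial (Fin 4) k)) [2, 2, 4, 4] := by
  have h := isMaxInv_X_pow_mul_X_add_X_pow_mul_X (k := k) (N := 4) (a := 0) (b := 1) (c := 2) (d := 3)
    (m := 3) (n := 1) (by decide) (by decide) (by decide) (by decide) (by decide) (by decide) (by norm_num)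
    le_rfl
  rw [pow_one] at h
  norm_num at h
  exact h

/-- `x y + z³ w ↦ (2, 2, 4, 4)` in characteristic `2` (where `2 ∣ 4 = n + 1`): no characteristic hypothesis
anywhere. (derived here) [cite: AbramovichTemkinWlodarczyk2024, Thm. 5.3.1 (2)–(3) (p. 1578)] -/
example [CharP k 2] :
    IsMaxInv (admissibleInvariants (X 0 * X 1 + X 2 ^ 3 * X 3 : MvPolynomial (Fin 4) k)) [2, 2, 4, 4] := by
  have h := isMaxInv_X_pow_mul_X_add_X_pow_mul_X (k := k) (N := 4) (a := 0) (b := 1) (c := 2) (d := 3)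
    (m := 1) (n := 3) (by decide) (by decide) (by decide) (by decide) (by decide) (by decide) le_rfl
    (by norm_num)
  rw [pow_one] at h
  norm_num at h
  exact h

/-- `τ(x y + z w) = 4` and `τ(x² y + z w) = 4` (spectators allowed), every field. (derived here)
[cite: CossartJannsenSaito2020, Def. 1.26 / Lemma 1.27] -/
example : hironakaTau k {(X 0 * X 1 + X 2 * X 3 : MvPolynomial (Fin 6) k)} = 4 ∧
    hironakaTau k {(X 0 ^ 2 * X 1 + X 2 * X 3 : MvPolynomial (Fin 6) k)} = 4 := by
  have h1 := hironakaTau_twoHandles (k := k) (N := 6) (a := 0) (b := 1) (c := 2) (d := 3) (m := 1) (n := 1)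
    (by decide) (by decide) (by decide) (by decide) (by decide) (by decide) le_rfl le_rfl
  have h2 := hironakaTau_twoHandles (k := k) (N := 6) (a := 0) (b := 1) (c := 2) (d := 3) (m := 2) (n := 1)
    (by decide) (by decide) (by decide) (by decide) (by decide) (by decide) (by norm_num) le_rfl
  rw [twoHandles, pow_one, pow_one] at h1
  rw [twoHandles, pow_one] at h2
  exact ⟨h1, h2⟩

end Literature.AlgebraicGeometry.Resolution.WeightedBlowup

end
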